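import Summits.HubbardSuperconductivity.HubbardSuperconductivity.Theorems.NodalDiracTwistDiskTrivialHolonomyGrid

/-!
# Route `NodalDiracTwist` — crux `NodalDiracWeakCoupling`, line `birth`: Möbius sign, part 1 (elementary lemmas)

Helper file (`--supports stmt-HubbardSuperconductivity-10370`) for the lead's assembly stub
`stub_moebiusAbstract` (the abstract Longuet-Higgins theorem: a conical two-fold crossing of the
sector ground state forces `ℤ₂` holonomy `-1` on small circles). Elementary ingredients, all over a
finite index type `ι` with the sesquilinear dot product `⟨u, v⟩ = star u ⬝ᵥ v`:
* Cauchy–Schwarz for `star u ⬝ᵥ v` (via `EuclideanSpace`), and its two uses for small error vectors;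
* the LINK-SIGN lemma `link_sign`: if two unit vectors `s, s'` have real overlaps `t, t'` with two
  unit "ideal" vectors `f, f'` satisfying `t², t'² ≥ 1 - η` (`η ≤ 1/64`) and the ideal link
  `Re ⟨f, f'⟩` is `≥ 1/2` in modulus with sign `κ`, then `κ t t' Re ⟨s, s'⟩ > 0`;
* the cyclic bookkeeping `prod_neg_of_link_signs`: real links `ℓ_i` around a cycle with
  `κ_i t_i t_{i+1} ℓ_i > 0`, `κ_i = -1` exactly at the wrap-around index, have negative product;
* the mesh lemma `mesh_of_unit_continuous`: a continuous unit-modulus `E : ℝ → ℂ` has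
  `Re (conj (E θ) E θ') ≥ 1/2` for `θ, θ' ∈ [0, 7]` at distance `≤ 2π/n`, `n` large.
Sources: Fukui–Hatsugai–Suzuki, J. Phys. Soc. Jpn. 74 (2005) 1674 (lattice link variables);
Longuet-Higgins, Proc. R. Soc. A 344 (1975) 147. No definitions.
-/

-- the mandated namespace `Summit.<Summit>.<Problem>.Theorems` repeats `HubbardSuperconductivity`
-- (single-problem summit, D-0017), which the `dupNamespace` linter flags on every declaration
set_option linter.dupNamespace false

namespace Summit.HubbardSuperconductivity.HubbardSuperconductivity.Theorems.NodalDiracTwist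

open Matrix Complex
open scoped ComplexOrder InnerProductSpace

variable {ι : Type*} [Fintype ι]

/-! ### Cauchy–Schwarz for the sesquilinear dot product -/

/-- **Cauchy–Schwarz** for `⟨u, v⟩ = star u ⬝ᵥ v`: `|⟨u, v⟩|² ≤ Re⟨u, u⟩ · Re⟨v, v⟩`
(transport to `EuclideanSpace ℂ ι`, where `⟪x, y⟫ = star x ⬝ᵥ y`). [folklore] -/
theorem norm_star_dotProduct_sq_le (u v : ι → ℂ) :
    ‖star u ⬝ᵥ v‖ ^ 2 ≤ (star u ⬝ᵥ u).re * (star v ⬝ᵥ v).re := by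
  have h1 : ∀ x y : ι → ℂ, star x ⬝ᵥ y =
      ⟪(WithLp.toLp 2 x : EuclideanSpace ℂ ι), WithLp.toLp 2 y⟫_ℂ := fun x y => by
    rw [EuclideanSpace.inner_toLp_toLp, dotProduct_comm]
  have hu : (star u ⬝ᵥ u).re = ‖(WithLp.toLp 2 u : EuclideanSpace ℂ ι)‖ ^ 2 := by
    have h := inner_self_eq_norm_sq (𝕜 := ℂ) (WithLp.toLp 2 u : EuclideanSpace ℂ ι)
    rw [RCLike.re_to_complex] at h
    rw [h1]; exact h
  have hv : (star v ⬝ᵥ v).re = ‖(WithLp.toLp 2 v : EuclideanSpace ℂ ι)‖ ^ 2 := by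
    have h := inner_self_eq_norm_sq (𝕜 := ℂ) (WithLp.toLp 2 v : EuclideanSpace ℂ ι)
    rw [RCLike.re_to_complex] at h
    rw [h1]; exact h
  rw [hu, hv, h1, ← mul_pow]
  exact pow_le_pow_left₀ (norm_nonneg _) (norm_inner_le_norm _ _) 2

/-- A unit vector against a small vector: `⟨f, f⟩ = 1`, `Re⟨d, d⟩ ≤ η` give `|⟨f, d⟩| ≤ √η`.
[folklore] -/
theorem norm_star_dotProduct_le_sqrt {f d : ι → ℂ} (hf : star f ⬝ᵥ f = 1) {η : ℝ}
    (hd : (star d ⬝ᵥ d).re ≤ η) : ‖star f ⬝ᵥ d‖ ≤ Real.sqrt η := by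
  have h := norm_star_dotProduct_sq_le f d
  rw [hf, Complex.one_re, one_mul] at h
  calc ‖star f ⬝ᵥ d‖ = Real.sqrt (‖star f ⬝ᵥ d‖ ^ 2) := by
        rw [Real.sqrt_sq (norm_nonneg _)]
    _ ≤ Real.sqrt η := Real.sqrt_le_sqrt (h.trans hd)

/-- A small vector against a unit vector: `|⟨d, f⟩| ≤ √η`. [folklore] -/
theorem norm_star_dotProduct_le_sqrt' {f d : ι → ℂ} (hf : star f ⬝ᵥ f = 1) {η : ℝ}
    (hd : (star d ⬝ᵥ d).re ≤ η) : ‖star d ⬝ᵥ f‖ ≤ Real.sqrt η := by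
  rw [star_dotProduct_comm_conj, Complex.norm_conj]
  exact norm_star_dotProduct_le_sqrt hf hd

/-- Two small vectors: `Re⟨d, d⟩ ≤ η`, `Re⟨d', d'⟩ ≤ η`, `0 ≤ η` give `|⟨d, d'⟩| ≤ η`. [folklore] -/
theorem norm_star_dotProduct_le_of_re_le {d d' : ι → ℂ} {η : ℝ} (hη : 0 ≤ η)
    (hd : (star d ⬝ᵥ d).re ≤ η) (hd' : (star d' ⬝ᵥ d').re ≤ η) : ‖star d ⬝ᵥ d'‖ ≤ η := by
  have h := norm_star_dotProduct_sq_le d d'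
  have h0 : 0 ≤ (star d ⬝ᵥ d).re := by rw [star_dotProduct_self_re]; positivity
  have h2 : ‖star d ⬝ᵥ d'‖ ^ 2 ≤ η ^ 2 := by
    calc ‖star d ⬝ᵥ d'‖ ^ 2 ≤ (star d ⬝ᵥ d).re * (star d' ⬝ᵥ d').re := h
      _ ≤ η * η := mul_le_mul hd hd' (by rw [star_dotProduct_self_re]; positivity) hη
      _ = η ^ 2 := (sq η).symm
  exact (pow_le_pow_iff_left₀ (norm_nonneg _) hη two_ne_zero).1 h2

/-! ### The link-sign lemma -/

/-- **Link-sign lemma.** Let `f, f'` be unit "ideal" vectors and `s, s'` unit vectors whose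
overlaps `⟨f, s⟩ = t`, `⟨f', s'⟩ = t'` are REAL with `t², t'² ≥ 1 - η`, `η ≤ 1/64`. If the ideal
link satisfies `κ · Re⟨f, f'⟩ ≥ 1/2` for a sign `κ = ±1`, then the true link has the sign of
`κ t t'`: `0 < κ t t' Re⟨s, s'⟩`. (Write `s = t f + d` with `‖d‖² = 1 - t² ≤ η`; the three error
terms are `≤ 2√η + η ≤ 17/64 < (1 - η)²/2`.) [folklore] -/
theorem link_sign {f f' s s' : ι → ℂ} {t t' η κ : ℝ} (hf : star f ⬝ᵥ f = 1)
    (hf' : star f' ⬝ᵥ f' = 1) (hs : star s ⬝ᵥ s = 1) (hs' : star s' ⬝ᵥ s' = 1)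
    (hfs : star f ⬝ᵥ s = (t : ℂ)) (hfs' : star f' ⬝ᵥ s' = (t' : ℂ)) (hη0 : 0 ≤ η)
    (hη : η ≤ 1 / 64) (ht : 1 - η ≤ t ^ 2) (ht' : 1 - η ≤ t' ^ 2) (hκ : κ = 1 ∨ κ = -1)
    (hL : 1 / 2 ≤ κ * (star f ⬝ᵥ f').re) :
    0 < κ * t * t' * (star s ⬝ᵥ s').re := by
  -- the error vectors
  set d := s - (t : ℂ) • f with hd
  set d' := s' - (t' : ℂ) • f' with hd'
  have hsf : star s ⬝ᵥ f = (t : ℂ) := by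
    rw [star_dotProduct_comm_conj, hfs, Complex.conj_ofReal]
  have hsf' : star s' ⬝ᵥ f' = (t' : ℂ) := by
    rw [star_dotProduct_comm_conj, hfs', Complex.conj_ofReal]
  have hdd : (star d ⬝ᵥ d).re = 1 - t ^ 2 := by
    have : star d ⬝ᵥ d = 1 - (t : ℂ) ^ 2 := by
      simp only [hd, star_sub, star_smul, sub_dotProduct, dotProduct_sub, smul_dotProduct,
        dotProduct_smul, smul_eq_mul, hs, hf, hfs, hsf, Complex.star_def, Complex.conj_ofReal]
      ring
    rw [this, Complex.sub_re, Complex.one_re, ← Complex.ofReal_pow, Complex.ofReal_re]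
  have hdd' : (star d' ⬝ᵥ d').re = 1 - t' ^ 2 := by
    have : star d' ⬝ᵥ d' = 1 - (t' : ℂ) ^ 2 := by
      simp only [hd', star_sub, star_smul, sub_dotProduct, dotProduct_sub, smul_dotProduct,
        dotProduct_smul, smul_eq_mul, hs', hf', hfs', hsf', Complex.star_def, Complex.conj_ofReal]
      ring
    rw [this, Complex.sub_re, Complex.one_re, ← Complex.ofReal_pow, Complex.ofReal_re]
  have hdη : (star d ⬝ᵥ d).re ≤ η := by rw [hdd]; linarith
  have hdη' : (star d' ⬝ᵥ d').re ≤ η := by rw [hdd']; linarith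
  -- `t², t'² ≤ 1`
  have ht1 : t ^ 2 ≤ 1 := by
    have h0 : 0 ≤ (star d ⬝ᵥ d).re := by rw [star_dotProduct_self_re]; positivity
    rw [hdd] at h0; linarith
  have ht1' : t' ^ 2 ≤ 1 := by
    have h0 : 0 ≤ (star d' ⬝ᵥ d').re := by rw [star_dotProduct_self_re]; positivity
    rw [hdd'] at h0; linarith
  have hta : |t| ≤ 1 := (sq_le_one_iff_abs_le_one t).1 ht1
  have hta' : |t'| ≤ 1 := (sq_le_one_iff_abs_le_one t').1 ht1'
  -- expansion of the true link
  have hexp : star s ⬝ᵥ s' = (t : ℂ) * (t' : ℂ) * (star f ⬝ᵥ f') +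
      ((t : ℂ) * (star f ⬝ᵥ d') + (t' : ℂ) * (star d ⬝ᵥ f') + star d ⬝ᵥ d') := by
    have hs1 : s = (t : ℂ) • f + d := by rw [hd, add_sub_cancel]
    have hs2 : s' = (t' : ℂ) • f' + d' := by rw [hd', add_sub_cancel]
    conv_lhs => rw [hs1, hs2]
    simp only [star_add, star_smul, add_dotProduct, dotProduct_add, smul_dotProduct,
      dotProduct_smul, smul_eq_mul, Complex.star_def, Complex.conj_ofReal]
    ring
  -- the error terms
  have hsq : Real.sqrt η ≤ 1 / 8 := by
    rw [show (1 : ℝ) / 8 = Real.sqrt ((1 / 8) ^ 2) by rw [Real.sqrt_sq (by norm_num)]]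
    exact Real.sqrt_le_sqrt (by linarith)
  have he1 : ‖(t : ℂ) * (star f ⬝ᵥ d')‖ ≤ 1 / 8 := by
    rw [norm_mul, Complex.norm_real, Real.norm_eq_abs]
    calc |t| * ‖star f ⬝ᵥ d'‖ ≤ 1 * Real.sqrt η :=
          mul_le_mul hta (norm_star_dotProduct_le_sqrt hf hdη') (norm_nonneg _) zero_le_one
      _ ≤ 1 / 8 := by rw [one_mul]; exact hsq
  have he2 : ‖(t' : ℂ) * (star d ⬝ᵥ f')‖ ≤ 1 / 8 := by
    rw [norm_mul, Complex.norm_real, Real.norm_eq_abs]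
    calc |t'| * ‖star d ⬝ᵥ f'‖ ≤ 1 * Real.sqrt η :=
          mul_le_mul hta' (norm_star_dotProduct_le_sqrt' hf' hdη) (norm_nonneg _) zero_le_one
      _ ≤ 1 / 8 := by rw [one_mul]; exact hsq
  have he3 : ‖star d ⬝ᵥ d'‖ ≤ 1 / 64 := (norm_star_dotProduct_le_of_re_le hη0 hdη hdη').trans hη
  set e := (t : ℂ) * (star f ⬝ᵥ d') + (t' : ℂ) * (star d ⬝ᵥ f') + star d ⬝ᵥ d' with he
  have he_norm : |e.re| ≤ 17 / 64 := by
    refine (Complex.abs_re_le_norm e).trans ?_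
    calc ‖e‖ ≤ ‖(t : ℂ) * (star f ⬝ᵥ d') + (t' : ℂ) * (star d ⬝ᵥ f')‖ + ‖star d ⬝ᵥ d'‖ :=
          norm_add_le _ _
      _ ≤ (‖(t : ℂ) * (star f ⬝ᵥ d')‖ + ‖(t' : ℂ) * (star d ⬝ᵥ f')‖) + ‖star d ⬝ᵥ d'‖ := by
          gcongr; exact norm_add_le _ _
      _ ≤ (1 / 8 + 1 / 8) + 1 / 64 := by gcongr
      _ = 17 / 64 := by norm_num
  -- the main term
  have hmain : (star s ⬝ᵥ s').re = t * t' * (star f ⬝ᵥ f').re + e.re := by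
    rw [hexp, Complex.add_re]
    congr 1
    rw [← Complex.ofReal_mul, Complex.re_ofReal_mul]
  rw [hmain]
  have hκ2 : κ * κ = 1 := by rcases hκ with h | h <;> rw [h] <;> norm_num
  have hκ1 : |κ| = 1 := by rcases hκ with h | h <;> rw [h] <;> norm_num
  -- `κ t t' (t t' L + e) = t² t'² (κ L) + κ t t' e ≥ (1-η)²/2 - 17/64 > 0`
  have h1 : κ * t * t' * (t * t' * (star f ⬝ᵥ f').re + e.re) =
      t ^ 2 * t' ^ 2 * (κ * (star f ⬝ᵥ f').re) + κ * t * t' * e.re := by ring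
  rw [h1]
  have h2 : (1 - η) * (1 - η) * (1 / 2) ≤ t ^ 2 * t' ^ 2 * (κ * (star f ⬝ᵥ f').re) := by
    have hη1 : 0 ≤ 1 - η := by linarith
    calc (1 - η) * (1 - η) * (1 / 2) ≤ t ^ 2 * t' ^ 2 * (1 / 2) := by
          gcongr
      _ ≤ t ^ 2 * t' ^ 2 * (κ * (star f ⬝ᵥ f').re) := by
          gcongr
  have h3 : |κ * t * t' * e.re| ≤ 17 / 64 := by
    rw [abs_mul, abs_mul, abs_mul, hκ1, one_mul]
    calc |t| * |t'| * |e.re| ≤ 1 * 1 * (17 / 64) := by gcongr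
      _ = 17 / 64 := by norm_num
  have h4 := (abs_le.1 h3).1
  nlinarith [h2, h4, hη, hη0]

/-! ### Cyclic bookkeeping of signs -/

/-- **Cyclic sign bookkeeping.** If real links `ℓ_i` around the cycle `i ↦ finRotate n i`
(`n ≥ 1`) satisfy `0 < κ_i t_i t_{σ i} ℓ_i` with `κ_i = -1` at the wrap-around index `n - 1` and
`κ_i = 1` otherwise, then `∏ ℓ_i < 0`: the `t`'s appear twice each and cancel in sign, one `-1`
survives. [folklore] -/
theorem prod_neg_of_link_signs {n : ℕ} (hn : 1 ≤ n) (ℓ t : Fin n → ℝ)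
    (h : ∀ i : Fin n, 0 < (if (i : ℕ) + 1 = n then (-1 : ℝ) else 1) * t i *
      t (finRotate n i) * ℓ i) :
    ∏ i, ℓ i < 0 := by
  have hprod : 0 < ∏ i : Fin n, ((if (i : ℕ) + 1 = n then (-1 : ℝ) else 1) * t i *
      t (finRotate n i) * ℓ i) := Finset.prod_pos fun i _ => h i
  rw [Finset.prod_mul_distrib, Finset.prod_mul_distrib, Finset.prod_mul_distrib,
    Equiv.prod_comp (finRotate n) t] at hprod
  -- the product of the signs is `-1`
  have hsign : ∏ i : Fin n, (if (i : ℕ) + 1 = n then (-1 : ℝ) else 1) = -1 := by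
    have hlast : (⟨n - 1, by omega⟩ : Fin n) ∈ Finset.univ := Finset.mem_univ _
    rw [← Finset.mul_prod_erase _ _ hlast]
    have h1 : (if ((⟨n - 1, by omega⟩ : Fin n) : ℕ) + 1 = n then (-1 : ℝ) else 1) = -1 := by
      rw [if_pos]; simp only; omega
    rw [h1, Finset.prod_eq_one, mul_one]
    intro i hi
    rw [Finset.mem_erase] at hi
    rw [if_neg]
    intro h'
    apply hi.1
    ext
    simp only
    omega
  rw [hsign] at hprod
  have hsq : 0 ≤ (∏ i, t i) * ∏ i, t i := mul_self_nonneg _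
  by_contra hneg
  push Not at hneg
  have : -1 * (∏ i, t i) * (∏ i, t i) * ∏ i, ℓ i ≤ 0 := by
    have : 0 ≤ (∏ i, t i) * (∏ i, t i) * ∏ i, ℓ i := mul_nonneg hsq hneg
    linarith
  exact absurd hprod (not_lt.2 this)

/-! ### The mesh lemma for a continuous unit-modulus curve -/

/-- For unit complex numbers, `Re (conj u · v) = 1 - |u - v|²/2`. [folklore] -/
theorem re_conj_mul_eq_of_unit {u v : ℂ} (hu : ‖u‖ = 1) (hv : ‖v‖ = 1) :
    ((starRingEnd ℂ) u * v).re = 1 - ‖u - v‖ ^ 2 / 2 := by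
  have h2 : ((starRingEnd ℂ) u * v).re = (u * (starRingEnd ℂ) v).re := by
    rw [← Complex.conj_re (u * (starRingEnd ℂ) v), map_mul, Complex.conj_conj, mul_comm]
  have h1 : ‖u - v‖ ^ 2 = ‖u‖ ^ 2 + ‖v‖ ^ 2 - 2 * (u * (starRingEnd ℂ) v).re := by
    rw [Complex.sq_norm, Complex.sq_norm, Complex.sq_norm, Complex.normSq_sub]
  rw [h2, h1, hu, hv]
  ring

/-- **Mesh lemma.** A continuous unit-modulus `E : ℝ → ℂ` is uniformly continuous on `[0, 7]`,
so for all fine meshes `n ≥ n₁` and all `θ, θ' ∈ [0, 7]` with `|θ - θ'| ≤ 2π/n` the overlap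
`Re (conj (E θ) E θ')` is at least `1/2`. [folklore] -/
theorem mesh_of_unit_continuous {E : ℝ → ℂ} (hE : Continuous E) (hE1 : ∀ θ, ‖E θ‖ = 1) :
    ∃ n₁ : ℕ, ∀ n ≥ n₁, ∀ θ ∈ Set.Icc (0 : ℝ) 7, ∀ θ' ∈ Set.Icc (0 : ℝ) 7,
      |θ - θ'| ≤ 2 * Real.pi / n → 1 / 2 ≤ ((starRingEnd ℂ) (E θ) * E θ').re := by
  have hK : IsCompact (Set.Icc (0 : ℝ) 7) := isCompact_Icc
  obtain ⟨δ, hδ0, hδ⟩ := Metric.uniformContinuousOn_iff.1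
    (hK.uniformContinuousOn_of_continuous hE.continuousOn) 1 one_pos
  obtain ⟨N, hN⟩ := exists_nat_gt (2 * Real.pi / δ)
  refine ⟨N + 1, fun n hn θ hθ θ' hθ' hd => ?_⟩
  have hn0 : (0 : ℝ) < n := by exact_mod_cast (by omega : 0 < n)
  have hNn : (N : ℝ) + 1 ≤ n := by exact_mod_cast hn
  have h2 : 2 * Real.pi / n < δ := by
    rw [div_lt_iff₀ hn0]
    rw [div_lt_iff₀ hδ0] at hN
    nlinarith [Real.pi_pos]
  have h1 := hδ θ hθ θ' hθ' (by rw [Real.dist_eq]; linarith)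
  rw [dist_eq_norm] at h1
  rw [re_conj_mul_eq_of_unit (hE1 θ) (hE1 θ')]
  have h3 : ‖E θ - E θ'‖ ^ 2 ≤ 1 := by
    have := h1.le
    calc ‖E θ - E θ'‖ ^ 2 ≤ 1 ^ 2 := pow_le_pow_left₀ (norm_nonneg _) this 2
      _ = 1 := one_pow 2
  linarith

end Summit.HubbardSuperconductivity.HubbardSuperconductivity.Theorems.NodalDiracTwist
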